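import Literature.NumberTheory.LFunctions.Zhang2022.KnifeEdgeMuPsiOverhang
import Literature.NumberTheory.LFunctions.Zhang2022.KnifeEdgeWallCross

/-!
# Zhang (2022), rung F-S3 (Landau–Siegel programme, family B-len): the νψ-overhang class — THE SHUT DOOR.
# Registry row E-074′ «ν-piece invisible-(A)» (`NuPieceInvisible`, was len-E9a E-len-lac-diag) typed over the
# skeleton, row E-075 (len-E9b) recorded as MOOT, and the kernel consequences PROVED: zero diagonal, `X = 0`,
# no closing of either sign, and the transfer theorem «an invisible piece changes no main term»

Y. Zhang, *Discrete mean estimates and the Landau–Siegel zero*, arXiv:2211.02515v1 [Zhang2022LandauSiegel] —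
an unrefereed manuscript under adjudication. **WHAT THIS IS NOT: not a claim about Theorems 1–2 of
arXiv:2211.02515, about Landau–Siegel zeros, or about Parity. The programme SEARCHES and TYPES; nothing here
asserts any estimate: `NuPieceInvisible`, `NuMeanInvisible`, `NuDict`, `NuCloses`, `NuCrossForm`, `RobustNuMargin`
are bare `Prop`s (registry rows E-074′ / E-075 of `obj/EDREGISTRY.md`, local ids len-E9a / len-E9b of
`B-len/EDLIST.md` v1.2; status «derivation — RULED by ls-theory 17:33:45Z, desk, in-house, unreviewed; price S,
verdict-inert» resp. «MOOT — second order, not opened»), and every `theorem` is an implication between them and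
the named nodes of `SkeletonPropositions`, or finite-sum algebra.**

**The class (B-len/PLAN.md v1.2 §1 (L-b) «νψ», §2 S3 «the (A)-lacunarity door»).** `ν = 1 ∗ χ` is the manuscript's
§3 coefficient (`ζ(s)L(s,χ) = Σ ν(n)n^{−s}`; the tree's `Skeleton.nu χ = divisorSumChar χ`). A νψ-OVERHANG piece is
`A_ν(s,ψ) = Σ_{P < n ≤ P^θ} ν(n)ψ(n)v(z_n)n^{−s}`, `z_n = log n/log P`, `v` a profile on `[1, θ]`, `θ ∈ (1, 5/4]`. The
family asked ls-theory (Q→theory-len-1, -len-2, 17:01:47Z) for its (A)-world diagonal functional `𝔅_ν^{(θ)}` and for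
the status of its off-diagonal (shifted convolutions of `1∗χ` at shifts `kp`).

**THE RULING (ls-theory 17:33:45Z, adopted verbatim by ls-Blen-plan 18:02:59Z; EDLIST v1.2).** "THE DOOR IS SHUT:
a `ν = 1∗χ` overhang piece … is INVISIBLE AT MAIN ORDER in the (A)-world — no diagonal main term AND no off-diagonal
main term — because it is POINTWISE `o(‖v‖)` at every `s ∈ Ω₁` for every `ψ` outside an exceptional set of size
`O(𝔓𝓛^{−c})`." Mechanism = the manuscript's own §§3–4: the Dirichlet coefficients of `L(s,ψ)L(s,ψχ)` ARE `ν(n)ψ(n)`;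
the comparison function `F(s,ψ) = Σ_{n≤D⁴} ν(n)ψ(n)n^{−s}` (tex l.798) has length `D⁴` ONLY; Lemma 4.2 (tex
l.925–945) shows the ν-coefficients on `(D⁴, D⁸]` sum to `O(𝓛^{−227})` pointwise on `Ω₁` for `ψ ∈ Ψ₁` by partial
summation on (3.4)–(3.6), and (4.10) disposes of the whole middle range of the approximate functional equation the
same way; `Σ_{x<n≤y} ν(n)²/n` carries in every term of the increment beyond `n ≍ D^C` a factor `L(1,χ)·log y`, which
under (A) is `≪ 𝓛^{−2022}·𝓛⁹`: the ν-mass sits at `n ≤ D^{O(1)}`; the family large sieve (tex l.780–790, lengths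
`≤ P² ⊇ P^θ`) supplies the exceptional set. ANSWERS: (1) the diagonal functional is ZERO at main order
(`Σ_{P<n≤P^θ} ν(n)²|v(z_n)|²/n ≤ ‖v‖²_∞·L(1,χ)(θ−1)L_M(L(1,χ)(θ+1)L_M + 2|L′(1,χ)|)/ζ(2)·(1+o(1)) → 0`); (2) len-E9b is
NOT needed — «second order, moot» (it would compute an `o(1)`). CONSEQUENCE: `TRUE(u ⊕ v_ν) = TRUE(u) + o(main)` ⇒
no lever of either sign; the class is removed from the search space (the 48 `len-nu-*` designs of BATCH-1 are
evaluated witnesses only).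

**What is typed.** (E-074′, the row of record) `NuPieceInvisible θ c` — ls-theory's one-line Prop, in the vocabulary
of Prop. 2.1 (an exceptional set of characters of `ncard ≤ C𝔓𝓛^{−c}`) and of `KnifeEdgeInvisibleTail.tailInvisible_bv`
(sup `≤ B`, variation `≤ V` on `[1,θ]`), at sampled zeros on the line; its discrete-mean form `NuMeanInvisible c' θ 𝒱 S`
(the νψ polynomial of every `v ∈ 𝒱` has discrete mean `o(S·𝔓)` under (A)); the derivation-independent dictionary SHAPE
of the pre-draft (`nuPoly`, `NuDict c' θ 𝒱 S M X` with slots class/scale/diagonal/off-diagonal, `NuCloses 𝒱 M X`,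
`OverhangDiagBounded`, `NuCrossForm` = the E-075 existential — kept as the RECORD of what was considered, with the
EDLIST range-condition text — and `RobustNuMargin`); the BV overhang class `bvOverhang θ`.

**PROVED.** (i) `nuDict_zero_of_meanInvisible`: mean-invisibility IS the dictionary with the slots of record
`M ≡ 0`, `X = 0` (given Prop. 2.2 (i), Lemma 2.3); `not_nuCloses_of_invisible` / `not_nuCloses_of_record` /
`not_robustNuMargin_of_record` / `nuCrossForm_of_meanInvisible`: with those slots no profile closes, no robust margin
exists, and the E-075 existential holds with `X = 0` — THE DOOR IS SHUT in the kernel, modulo the S-priced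
derivation claim. (ii) THE TRANSFER THEOREM `mainTerm_add_meanInvisible` (finite-sum algebra `abs_discMean_add_sub_le`:
`|Ξ(F+G) − Ξ(F)| ≤ Ξ(G) + 2√(Ξ(F)Ξ(G))` from polarisation + weighted Cauchy–Schwarz of `KnifeEdgeWallCross`, p459102, then
an `ε/3`-bookkeeping): a mean-invisible piece added to ANY family of test values with main constant `m ≥ 0` at an
eventually positive scale leaves the main constant `m` — ls-theory's «TRUE(u + ν-piece) = TRUE(u) + o(main) ⇒ no lever
of either sign» as a kernel implication; `mainTerm_add_nuPiece` is the νψ instance. (iii) The generic class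
bookkeeping of the pre-draft: `theorem1_of_nuDict` / `theorem2_of_nuDict` (POS endgame via the scale-free
`eventually_not_assumptionA_of_negative_mainTerm_scale`, p458584), `nuCloses_of_robustMargin`, `theorem1_of_robustNuMargin`,
`not_nuCloses_of_nonneg`, `not_robustNuMargin_of_nonneg`, `nuCloses_mono_X`, `overhangDiagBounded_of_offDiagBoundedOn` /
`_zero`, `nu_class_inhabited_overhangPiece` (crit-1 (J1)), `bvOverhang_zero`, `nuPoly_zero_profile`.

NOT here: the derivation `NuPieceInvisible → NuMeanInvisible` (exceptional-set and weight-mass bookkeeping, rows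
E-009/Prop 2.1 — part of the S-priced derivation), any proof of `NuPieceInvisible` (in-house claim, unreviewed), rows
E-070/E-071 (Λ, ls-Blen-typer-1), E-072/E-073 (μψ, `KnifeEdgeMuPsiOverhang.lean`).
References: Zhang, arXiv:2211.02515v1, §2 (2.16), Prop. 2.1, §3 p. 6 (`ν`), (3.4)–(3.6), §4 Lemma 4.2, (4.10), §7
Prop 7.1 (7.2); tex l.780–790, l.798, l.925–945 [cite: Zhang2022LandauSiegel, §2 (2.16), Prop. 2.1, §3 (3.5), §4
Lemma 4.2, (4.10)]; cell files B-len/EDLIST.md v1.2 (E-074′, E-075), B-len/PLAN.md v1.2 §2 S3, ls-theory INBOX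
17:33:45Z, ls-Blen-plan INBOX 18:02:59Z; tree `Skeleton.nu` / `PsiOne` / `zeroSet` / `Prop21`, `KnifeEdge.discMean`
(p456081), `KnifeEdge.discPolar` / `discMean_add` / `norm_sq_discPolar_le` (p459102), `KnifeEdge.OffDiagForm` /
`OffDiagBoundedOn` / `overhangNorm` (p458017), `KnifeEdge.Scale` / `eventually_not_assumptionA_of_negative_mainTerm_scale`
(p458584), `KnifeEdgeInvisibleTail.tailInvisible_bv` (p457384/p457577), `KnifeEdge.overhangPiece_phiT` (p442741).
-/

noncomputable section

open Complex Real Set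
open _root_.MeasureTheory intervalIntegral

namespace Literature.NumberTheory.LFunctions.Zhang2022

namespace KnifeEdge

open Repair Skeleton

/-! ### Part 1 — the νψ profile polynomial (definition) -/

/-- **The νψ profile polynomial of length `N`:** `Σ_{1≤n<N} ν(n)·ψ(n)·v(log n/log P)·n^{−s}`, `ν = 1 ∗ χ`
(`Skeleton.nu χ`), for the member `x = (p, ψ)` of `Ψ`; an OVERHANG piece is the case `v = 0` on `[0,1]`
(then only `P < n < N` contribute). [cite: Zhang2022LandauSiegel, §3 p. 6, §2 (2.16)] -/
def nuPoly {D : ℕ} [NeZero D] (χ : DirichletCharacter ℂ D) (x : Chr D) (v : ℝ → ℂ) (N : ℕ) (s : ℂ) : ℂ :=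
  ∑ n ∈ Finset.Ico 1 N,
    nu χ n * x.ψ (n : ZMod x.p) * v (Real.log n / Real.log (bigP D)) * (n : ℂ) ^ (-s)

/-- The νψ polynomial of the zero profile vanishes. [cite: Zhang2022LandauSiegel, §2 (2.16)] -/
theorem nuPoly_zero_profile {D : ℕ} [NeZero D] (χ : DirichletCharacter ℂ D) (x : Chr D) (N : ℕ) (s : ℂ) :
    nuPoly χ x (fun _ => 0) N s = 0 := by
  simp [nuPoly]

/-! ### Part 2 — rows len-E9a ⊕ len-E9b: the (A)-world dictionary of the class and its decision statement
(bare `Prop`s with named slots `𝒱`, `S`, `M`, `X`; none asserted) -/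

/-- **len-E9a ⊕ len-E9b — the ⟨A⟩-DICTIONARY of the class «νψ overhang, top `θ > 1`» with named slots** (profile
class `𝒱`, scale `S`, diagonal functional `M` = len-E9a's `𝔅_ν^{(θ)}`, off-diagonal pair functional `X` = len-E9b's
`X_ν`): `1 < θ`, and under (A), for every profile `v ∈ 𝒱` (with marked right derivative `v′`), the discrete mean
(2.16) of the νψ polynomial of length `⌈P^θ⌉` is `(M(v,v′) + Re X(v,v′,v,v′))·S(D,χ)·𝔓 + o(S·𝔓)`. Status:
derivation asked of ls-theory (`𝒱`, `S`, `M`); `X` OPEN IN PRINT. Nothing asserted.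
[cite: Zhang2022LandauSiegel, §2 (2.16), §5, §7 Prop 7.1 (7.2)] -/
def NuDict (c' θ : ℝ) (𝒱 : (ℝ → ℂ) → (ℝ → ℂ) → Prop) (S : Scale) (M : (ℝ → ℂ) → (ℝ → ℂ) → ℝ)
    (X : PairFunctional) : Prop :=
  1 < θ ∧ ∀ v v' : ℝ → ℂ, 𝒱 v v' →
    ∀ ε : ℝ, 0 < ε → ForAllLarge fun D _ χ => AssumptionA D χ →
      |discMean c' χ (fun x s => nuPoly χ x v ⌈bigP D ^ θ⌉₊ s)
          - (M v v' + (X v v' v v').re) * S D χ * frakP D| ≤ ε * S D χ * frakP D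

/-- **The class CLOSES — decision statement** (D-len-1 criterion (3), the νψ piece alone at `s = 0`): some
`v ∈ 𝒱` has NEGATIVE completed constant `M(v,v′) + Re X(v,v′,v,v′) < 0`. Prediction B-AH (E-014) and ls-ref-1's
price note (len-E9a verdict-inert, `𝔅_ν^{(θ)} ≥ 0`): closing can only come through `X`.
[cite: Zhang2022LandauSiegel, §2 (2.16)] -/
def NuCloses (𝒱 : (ℝ → ℂ) → (ℝ → ℂ) → Prop) (M : (ℝ → ℂ) → (ℝ → ℂ) → ℝ) (X : PairFunctional) : Prop :=
  ∃ v v' : ℝ → ℂ, 𝒱 v v' ∧ M v v' + (X v v' v v').re < 0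

/-! ### Part 3 — PROVED: the class's `Theorem1` implication by positivity alone -/

section Endgame

variable {c' θ : ℝ} {𝒱 : (ℝ → ℂ) → (ℝ → ℂ) → Prop} {S : Scale} {M : (ℝ → ℂ) → (ℝ → ℂ) → ℝ}
  {X : PairFunctional}

/-- **POS endgame for the νψ class (kernel implication):** dictionary + admissible scale + closing + Zhang's
Part-1 zero model ⇒ Theorem 1 of the manuscript — via the scale-free
`eventually_not_assumptionA_of_negative_mainTerm_scale`. Every analytic hypothesis is a named open row;
nothing asserted. [cite: Zhang2022LandauSiegel, §2 p. 6, (2.16)] -/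
theorem theorem1_of_nuDict (hE : NuDict c' θ 𝒱 S M X) (hS : ScaleEventuallyPos S) (hC : NuCloses 𝒱 M X)
    (h22 : Prop22i) (h23 : Lemma23 c') : Theorem1 := by
  obtain ⟨v, v', hv, hneg⟩ := hC
  exact Skeleton.theorem1_of_eventually_not_assumptionA
    (eventually_not_assumptionA_of_negative_mainTerm_scale hneg hS
      (F := fun D _ χ x s => nuPoly χ x v ⌈bigP D ^ θ⌉₊ s) (hE.2 v v' hv) h22 h23)

/-- … and Theorem 2. [cite: Zhang2022LandauSiegel, §1 Theorem 2] -/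
theorem theorem2_of_nuDict (hE : NuDict c' θ 𝒱 S M X) (hS : ScaleEventuallyPos S) (hC : NuCloses 𝒱 M X)
    (h22 : Prop22i) (h23 : Lemma23 c') : Theorem2 :=
  Skeleton.theorem2_of_theorem1 (theorem1_of_nuDict hE hS hC h22 h23)

/-- **Obstruction bookkeeping (B-AH side / ls-ref-1's «verdict-inert» note):** a completed class functional
`M + Re X(·,·) ≥ 0` on `𝒱` never closes. [cite: Zhang2022LandauSiegel, §2 (2.16)] -/
theorem not_nuCloses_of_nonneg (h : ∀ v v' : ℝ → ℂ, 𝒱 v v' → 0 ≤ M v v' + (X v v' v v').re) :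
    ¬ NuCloses 𝒱 M X := by
  rintro ⟨v, v', hv, hneg⟩
  exact not_lt.2 (h v v' hv) hneg

/-- Closing is monotone in the off-diagonal slot: an `X′` with `Re X′(v,v) ≤ Re X(v,v)` on `𝒱` closes whenever
`X` does. [cite: Zhang2022LandauSiegel, §2 (2.16)] -/
theorem nuCloses_mono_X {X' : PairFunctional}
    (hXX : ∀ v v' : ℝ → ℂ, 𝒱 v v' → (X' v v' v v').re ≤ (X v v' v v').re) (h : NuCloses 𝒱 M X) :
    NuCloses 𝒱 M X' := by
  obtain ⟨v, v', hv, hneg⟩ := h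
  exact ⟨v, v', hv, by have := hXX v v' hv; linarith⟩

end Endgame

/-! ### Part 4 — row len-E9b priced: `C`-bounded off-diagonal input on the class, `NuCrossForm`, and the robust
criterion (proved) -/

section Robust

/-- **`C`-bounded off-diagonal input on the overhang class `𝒱`** (the diagonal-slot half of D-len-1's
`OffDiagBoundedOn θ C X 𝒱`, p458017, which is what the single-piece decision reads): `|Re X(v,v′,v,v′)| ≤ C·N_θ(v)²`
with `N_θ(v) = KnifeEdge.overhangNorm θ v v′ = (∫₁^θ |v|² + |v′|²)^{1/2}`. Bare predicate, asserted for no `X`.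
[cite: Zhang2022LandauSiegel, §7 (7.2) p.44] -/
def OverhangDiagBounded (θ C : ℝ) (X : PairFunctional) (𝒱 : (ℝ → ℂ) → (ℝ → ℂ) → Prop) : Prop :=
  ∀ v v' : ℝ → ℂ, 𝒱 v v' → |(X v v' v v').re| ≤ C * overhangNorm θ v v' ^ 2

/-- D-len-1's two-slot bound implies the diagonal-slot bound. [cite: Zhang2022LandauSiegel, §7 (7.2) p.44] -/
theorem overhangDiagBounded_of_offDiagBoundedOn {θ C : ℝ} {X : PairFunctional}
    {𝒱 : (ℝ → ℂ) → (ℝ → ℂ) → Prop} (h : OffDiagBoundedOn θ C X 𝒱)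
    (h0 : InClassPiece (fun _ => (0 : ℂ)) (fun _ => (0 : ℂ))) : OverhangDiagBounded θ C X 𝒱 :=
  fun v v' hv => (h _ _ v v' h0 hv).2

/-- `X = 0` is `C`-bounded for `C ≥ 0`. [cite: Zhang2022LandauSiegel, §7 (7.2) p.44] -/
theorem overhangDiagBounded_zero {θ C : ℝ} (hC : 0 ≤ C) (𝒱 : (ℝ → ℂ) → (ℝ → ℂ) → Prop) :
    OverhangDiagBounded θ C 0 𝒱 := fun v v' _ => by
  simpa using mul_nonneg hC (sq_nonneg (overhangNorm θ v v'))

/-- **len-E9b / E-075 — `NuCrossForm c' θ C 𝒱 S M`, the priced existential, KEPT AS THE RECORD OF WHAT WAS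
CONSIDERED (status MOOT per ls-theory 17:33:45Z: «len-E9b … is NOT needed for any first-wave verdict (it would
compute an o(1)); do not open it as a priced row»; registry «moot-not-required», Q→obj 18:02:59Z).** Shape (EDLIST
D-len-4): the class's off-diagonal main term is SOME off-diagonal form (`KnifeEdge.OffDiagForm`, D-len-1) whose diagonal
slot is `C`-bounded on `𝒱` and for which `NuDict c' θ 𝒱 S M ·` holds; with the slots of record it holds with `X = 0`
(`nuCrossForm_of_meanInvisible`). The RANGE CONDITION text of the row, verbatim (EDLIST v1.1/v1.2 len-E9b, ls-ref-1 §9):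
«the shifts are `h = kp` with `p ∼ P = N^{1/θ}`, `N = P^θ`, `0 < |k| ≤ P^{θ−1}`, so EVERY shift has
`h ≥ P = N^{1/θ} ≥ N^{2/3}` for `θ ≤ 3/2` — beyond DFI94's uniformity range `h ≤ N^{2/3}` for the binary additive divisor
problem (most of the k-range at any `θ ∈ (1, 5/4]`); the typed row must say HOW these shifts are handled, candidates for
the derivation: (α) spectral decomposition of shifted convolution sums for the weight-1 theta series of discriminant
`−D` (genus Eisenstein part + dihedral cusp forms), polynomially uniform in `h ≤ N` but with LEVEL-`D` dependence that
must be beaten by the `L(1,χ)`-suppressed main term under (A); (β) large-shift additive-divisor uniformity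
(Meurman-2001-type) adapted to `1∗χ`; (γ) the extra averages over `k` and over `p` prime with smooth weights» — HOW
HANDLED (ls-theory 17:33:45Z (2)): none of (α)/(β)/(γ) is needed; «the off-diagonal never has to be isolated, because
the piece itself is pointwise negligible at the sampled zeros for density-one ψ». [cite: Zhang2022LandauSiegel, §2 (2.16), §4 Lemma 4.2, §7 Prop 7.1 (7.2)] -/
def NuCrossForm (c' θ C : ℝ) (𝒱 : (ℝ → ℂ) → (ℝ → ℂ) → Prop) (S : Scale) (M : (ℝ → ℂ) → (ℝ → ℂ) → ℝ) :
    Prop :=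
  ∃ X : PairFunctional, OffDiagForm θ X ∧ OverhangDiagBounded θ C X 𝒱 ∧ NuDict c' θ 𝒱 S M X

/-- **The ROBUST closing criterion of the class:** some `v ∈ 𝒱` has `M(v,v′) + C·N_θ(v)² < 0` — then the class
closes against EVERY off-diagonal input that is `C`-bounded on `𝒱`. [cite: Zhang2022LandauSiegel, §2 (2.16)] -/
def RobustNuMargin (θ C : ℝ) (𝒱 : (ℝ → ℂ) → (ℝ → ℂ) → Prop) (M : (ℝ → ℂ) → (ℝ → ℂ) → ℝ) : Prop :=
  ∃ v v' : ℝ → ℂ, 𝒱 v v' ∧ M v v' + C * overhangNorm θ v v' ^ 2 < 0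

variable {c' θ C : ℝ} {𝒱 : (ℝ → ℂ) → (ℝ → ℂ) → Prop} {S : Scale} {M : (ℝ → ℂ) → (ℝ → ℂ) → ℝ}
  {X : PairFunctional}

/-- A robust margin closes the class against every `C`-bounded off-diagonal input.
[cite: Zhang2022LandauSiegel, §2 (2.16)] -/
theorem nuCloses_of_robustMargin (h : RobustNuMargin θ C 𝒱 M) (hX : OverhangDiagBounded θ C X 𝒱) :
    NuCloses 𝒱 M X := by
  obtain ⟨v, v', hv, hlt⟩ := h
  refine ⟨v, v', hv, ?_⟩
  have hle : (X v v' v v').re ≤ C * overhangNorm θ v v' ^ 2 := (abs_le.mp (hX v v' hv)).2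
  linarith

/-- … hence Theorem 1 of the manuscript for every such `X`, given the dictionary at an admissible scale
(kernel implication; all analytic hypotheses are named open rows). [cite: Zhang2022LandauSiegel, §2 p. 6, (2.16)] -/
theorem theorem1_of_robustNuMargin (h : RobustNuMargin θ C 𝒱 M) (hX : OverhangDiagBounded θ C X 𝒱)
    (hE : NuDict c' θ 𝒱 S M X) (hS : ScaleEventuallyPos S) (h22 : Prop22i) (h23 : Lemma23 c') : Theorem1 :=
  theorem1_of_nuDict hE hS (nuCloses_of_robustMargin h hX) h22 h23

/-- No robust margin when the class diagonal is `≥ 0` on `𝒱` and `C ≥ 0` (ls-ref-1: `𝔅_ν^{(θ)}` is the main term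
of a sum of `|·|²`). [cite: Zhang2022LandauSiegel, §2 (2.16)] -/
theorem not_robustNuMargin_of_nonneg (hC : 0 ≤ C)
    (hM : ∀ v v' : ℝ → ℂ, 𝒱 v v' → 0 ≤ M v v') : ¬ RobustNuMargin θ C 𝒱 M := by
  rintro ⟨v, v', hv, hlt⟩
  have := add_nonneg (hM v v' hv) (mul_nonneg hC (sq_nonneg (overhangNorm θ v v')))
  linarith

end Robust

/-! ### Part 5 — PROVED: the top-vanishing overhang class is inhabited (crit-1's (J1) junk test) -/

/-- With `𝒱 = KnifeEdge.OverhangPiece θ` (smooth top-vanishing overhangs, p442741) the class is inhabited at every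
`θ > 1` by Zhang's ramp `φ_θ(y) = (y−1)(θ−y)` on `[1,θ]` (`KnifeEdge.overhangPiece_phiT`).
[cite: Zhang2022LandauSiegel, §7 (7.2) p.44] -/
theorem nu_class_inhabited_overhangPiece {θ : ℝ} (hθ : 1 < θ) :
    ∃ v v' : ℝ → ℂ, OverhangPiece θ v v' :=
  ⟨phiT θ, phiT' θ, overhangPiece_phiT hθ.le⟩

/-! ### Part 6 — THE DERIVATION'S ANSWER OF RECORD (ls-theory 17:33:45Z, A(Q→theory-len-1, -len-2), DESK,
in-house, unreviewed): the νψ piece is INVISIBLE at main order — typed as two bare `Prop`s (derivation status S)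
and their kernel consequences for the slots: `M = 0`, `X = 0`, the door is shut -/

section Ruling

/-- **len-E9a/E9b — the ruling, pointwise form (`NuPieceInvisible θ c`; derivation S, in-house, NOT asserted).**
ls-theory 17:33:45Z: "a `ν = 1∗χ` overhang piece `A_ν(s,ψ) := Σ_{P<n≤P^θ} ν(n)ψ(n)v(z_n)n^{−s}` (`v` PPE on
`[1,θ]`, `θ ≤ 5/4 < 2`) is INVISIBLE AT MAIN ORDER in the (A)-world — no diagonal main term AND no off-diagonal
main term — because it is POINTWISE `o(‖v‖)` at every `s ∈ Ω₁` for every `ψ` outside an exceptional set of size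
`O(𝔓𝓛^{−c})`", mechanism = the manuscript's own §§3–4: the coefficients of `L(s,ψ)L(s,ψχ)` ARE `ν(n)ψ(n)`, the
comparison function `F(s,ψ) = Σ_{n≤D⁴} ν(n)ψ(n)n^{−s}` (tex l.798) has length `D⁴` only, Lemma 4.2 (tex l.925–945) disposes of
the `ν`-coefficients on `(D⁴, D⁸]` by partial summation on (3.4)–(3.6) ((4.10) for the middle range), and `Σ_{x<n≤y} ν(n)²/n` carries a factor `L(1,χ)·log y ≪ 𝓛^{−2022+9}`
under (A) beyond `n ≍ D^C`; the family large sieve (tex l.780–790) supplies the exceptional set. Typed in the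
vocabulary of Prop. 2.1 (`ncard` of an exceptional set `≤ C𝔓𝓛^{−c}`) and of `KnifeEdgeInvisibleTail.tailInvisible_bv`
(sup `≤ B`, variation `≤ V` on `[1,θ]`), at sampled zeros ON THE LINE (`Re ρ = ½`, the Prop. 2.2 (i) world; off the
line the sum is not small). Suggested verbatim by ls-theory as «the one-line Prop … price S, verdict-inert (it only
closes a door)». [cite: Zhang2022LandauSiegel, §3 (3.5), §4 Lemma 4.2, (4.10), §2 Prop. 2.1] -/
def NuPieceInvisible (θ c : ℝ) : Prop :=
  ∃ C : ℝ, ForAllLarge fun D _ χ => AssumptionA D χ →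
    ∃ E : Set (Chr D), (E.ncard : ℝ) ≤ C * frakP D * (ell D ^ c)⁻¹ ∧
      ∀ x : Chr D, x ∉ E → ∀ ρ ∈ zeroSet D x, ρ.re = 1 / 2 →
        ∀ (v : ℝ → ℂ) (B V : ℝ), 0 ≤ B → 0 ≤ V → (∀ z, ‖v z‖ ≤ B) →
          eVariationOn v (Set.Icc 1 θ) ≤ ENNReal.ofReal V →
            ‖∑ n ∈ Finset.Ioc ⌊bigP D⌋₊ ⌊bigP D ^ θ⌋₊,
                nu χ n * x.ψ (n : ZMod x.p) * v (Real.log n / Real.log (bigP D)) * (n : ℂ) ^ (-ρ)‖ ≤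
              C * (B + V) * (ell D ^ c)⁻¹

/-- **len-E9a/E9b — the ruling at the level of the discrete mean (`NuMeanInvisible c' θ 𝒱 S`; derivation S,
NOT asserted):** under (A), for every profile of the class `𝒱`, the discrete mean (2.16) of the νψ polynomial of
length `⌈P^θ⌉` is `o(S·𝔓)` — ls-theory 17:33:45Z: "in the discrete mean `Σ_ρ 𝔠*ω|A_u + A_ν|²` the ν-piece changes the
value by `O(𝓛^{−c′})×(Σ𝔠*ω|A_u|²)^{1/2}(Σ𝔠*ω)^{1/2}`-type cross terms `+ O(𝓛^{−2c′})Σ𝔠*ω` — below main order once `c′`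
beats the polylog mass of the weights". (From `NuPieceInvisible` + the weight mass row E-009 + Prop. 2.1-type
bookkeeping of the exceptional set; that step is the derivation, not done here.) ANSWER (1) of the ruling: «the
diagonal functional is ZERO at main order»; ANSWER (2): «len-E9b … is NOT needed for any first-wave verdict (it
would compute an o(1)); … note it as second order, moot». [cite: Zhang2022LandauSiegel, §2 (2.16), §4 Lemma 4.2, (4.10)] -/
def NuMeanInvisible (c' θ : ℝ) (𝒱 : (ℝ → ℂ) → (ℝ → ℂ) → Prop) (S : Scale) : Prop :=
  1 < θ ∧ ∀ v v' : ℝ → ℂ, 𝒱 v v' →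
    ∀ ε : ℝ, 0 < ε → ForAllLarge fun D _ χ => AssumptionA D χ →
      discMean c' χ (fun x s => nuPoly χ x v ⌈bigP D ^ θ⌉₊ s) ≤ ε * S D χ * frakP D

/-- **The profile class of the ruling:** overhang profiles of BOUNDED VARIATION supported in `[1, θ]` (sup `≤ B`,
variation `≤ V` on `[1,θ]`, `v = 0` off `[1,θ]`; the derivative slot is not read — jumps allowed, as in row E-033).
[cite: Zhang2022LandauSiegel, §7 (7.2) p.44] -/
def bvOverhang (θ : ℝ) : (ℝ → ℂ) → (ℝ → ℂ) → Prop := fun v _ =>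
  (∃ B V : ℝ, 0 ≤ B ∧ 0 ≤ V ∧ (∀ z, ‖v z‖ ≤ B) ∧ eVariationOn v (Set.Icc 1 θ) ≤ ENNReal.ofReal V) ∧
    ∀ z, z < 1 ∨ θ < z → v z = 0

/-- The zero profile is in the class (non-vacuity of `bvOverhang`). [cite: Zhang2022LandauSiegel, §7 (7.2) p.44] -/
theorem bvOverhang_zero (θ : ℝ) : bvOverhang θ (fun _ => 0) (fun _ => 0) := by
  refine ⟨⟨0, 0, le_rfl, le_rfl, fun _ => by simp, ?_⟩, fun _ _ => rfl⟩
  rw [eVariationOn.constant_on]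
  · simp
  · exact (Set.subsingleton_singleton (a := (0 : ℂ))).anti (Set.image_subset_iff.2 fun _ _ => rfl)

variable {c' θ : ℝ} {𝒱 : (ℝ → ℂ) → (ℝ → ℂ) → Prop} {S : Scale}

/-- **Kernel consequence 1 — the slots of record are `M = 0`, `X = 0`:** mean-invisibility at scale `S` IS the
dictionary `NuDict c' θ 𝒱 S 0 0` (given Prop. 2.2 (i) and Lemma 2.3, which make discrete means `≥ 0`).
[cite: Zhang2022LandauSiegel, §2 (2.16), Lemma 2.3, Prop. 2.2 (i)] -/
theorem nuDict_zero_of_meanInvisible (h : NuMeanInvisible c' θ 𝒱 S) (h22 : Prop22i) (h23 : Lemma23 c') :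
    NuDict c' θ 𝒱 S (fun _ _ => 0) 0 := by
  refine ⟨h.1, fun v v' hv ε hε => ?_⟩
  have h3 : ForAllLarge fun D _ _ => 3 ≤ D := ForAllLarge.of_le 3 fun D _ _ hD _ _ => hD
  refine ((((h.2 v v' hv ε hε).and h22).and h23).and h3).mono ?_
  intro D _ χ _ _ h' hA
  obtain ⟨⟨⟨hup, h22'⟩, h23'⟩, hD3⟩ := h'
  have hw := weights_nonneg_of hD3 h23' h22'
  have hpos := discMean_nonneg hw (fun x s => nuPoly χ x v ⌈bigP D ^ θ⌉₊ s)
  have h0 : ((fun _ _ => (0 : ℝ)) v v' + ((0 : PairFunctional) v v' v v').re) * S D χ * frakP D = 0 := by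
    simp
  rw [h0, sub_zero, abs_of_nonneg hpos]
  exact hup hA

/-- **Kernel consequence 2 — THE DOOR IS SHUT:** with the slots of record (`M = 0`, `X = 0`) no profile of any
class closes, and no robust margin exists for any `C ≥ 0`; the priced row E-075 is met by `X = 0` itself
(`NuCrossForm … 0` from mean-invisibility). ls-theory: "no lever of either sign". [cite: Zhang2022LandauSiegel, §2 (2.16), §4 Lemma 4.2] -/
theorem not_nuCloses_of_record : ¬ NuCloses 𝒱 (fun _ _ => 0) 0 :=
  not_nuCloses_of_nonneg fun _ _ _ => by simp

/-- **`not_nuCloses_of_invisible` (the name ls-Blen-plan 18:02:59Z asked for; mirror of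
`KnifeEdge.not_closes_of_invisible`, p442741):** given mean-invisibility of the class at scale `S`, the dictionary
of record is `(M, X) = (0, 0)` AND the class does not close — no closing of either sign through a νψ overhang alone;
for a νψ overhang added to an arbitrary design see `mainTerm_add_nuPiece` (the main constant is unchanged).
[cite: Zhang2022LandauSiegel, §2 (2.16), §4 Lemma 4.2, (4.10)] -/
theorem not_nuCloses_of_invisible (h : NuMeanInvisible c' θ 𝒱 S) (h22 : Prop22i) (h23 : Lemma23 c') :
    NuDict c' θ 𝒱 S (fun _ _ => 0) 0 ∧ ¬ NuCloses 𝒱 (fun _ _ => 0) 0 :=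
  ⟨nuDict_zero_of_meanInvisible h h22 h23, not_nuCloses_of_record⟩

/-- … no robust margin for the diagonal of record. [cite: Zhang2022LandauSiegel, §2 (2.16), §4 Lemma 4.2] -/
theorem not_robustNuMargin_of_record {C : ℝ} (hC : 0 ≤ C) : ¬ RobustNuMargin θ C 𝒱 (fun _ _ => 0) :=
  not_robustNuMargin_of_nonneg hC fun _ _ _ => le_rfl

/-- … and the priced existential of row E-075 holds with `X = 0` for every `C ≥ 0`, given mean-invisibility
(kernel implication; `NuMeanInvisible` is the derivation's claim, not asserted). [cite: Zhang2022LandauSiegel, §2 (2.16), §7 (7.2)] -/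
theorem nuCrossForm_of_meanInvisible {C : ℝ} (h : NuMeanInvisible c' θ 𝒱 S) (h22 : Prop22i)
    (h23 : Lemma23 c') (hC : 0 ≤ C) : NuCrossForm c' θ C 𝒱 S (fun _ _ => 0) :=
  ⟨0, offDiagForm_zero θ, overhangDiagBounded_zero hC 𝒱, nuDict_zero_of_meanInvisible h h22 h23⟩

end Ruling

/-! ### Part 7 — PROVED: an invisible piece changes no main term («TRUE(u + ν-piece) = TRUE(u) + o(main)») -/

section Transfer

variable {c' : ℝ} {D : ℕ} {χ : DirichletCharacter ℂ D}

/-- **Pure algebra, every modulus:** with weights `Re 𝔠*·Re ω ≥ 0`,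
`|Ξ(F + G) − Ξ(F)| ≤ Ξ(G) + 2·√(Ξ(F)·Ξ(G))` (polarisation `KnifeEdge.discMean_add` + the weighted Cauchy–Schwarz
`norm_sq_discPolar_le`, p459102). [cite: Zhang2022LandauSiegel, §2 (2.16)–(2.17), Lemma 2.3] -/
theorem abs_discMean_add_sub_le (hw : ∀ i ∈ idx χ, 0 ≤ (cstar c' D i.1 i.2).re * (omegaW D i.2).re)
    (F G : Chr D → ℂ → ℂ) :
    |discMean c' χ (fun x s => F x s + G x s) - discMean c' χ F| ≤
      discMean c' χ G + 2 * Real.sqrt (discMean c' χ F * discMean c' χ G) := by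
  rw [discMean_add]
  have hG := discMean_nonneg hw G
  have hp : |(discPolar c' χ F G).re| ≤ Real.sqrt (discMean c' χ F * discMean c' χ G) := by
    refine (Complex.abs_re_le_norm _).trans ?_
    rw [← Real.sqrt_sq (norm_nonneg (discPolar c' χ F G))]
    exact Real.sqrt_le_sqrt (norm_sq_discPolar_le hw F G)
  calc |discMean c' χ F + discMean c' χ G + 2 * (discPolar c' χ F G).re - discMean c' χ F|
      = |discMean c' χ G + 2 * (discPolar c' χ F G).re| := by ring_nf
    _ ≤ |discMean c' χ G| + |2 * (discPolar c' χ F G).re| := abs_add_le _ _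
    _ = discMean c' χ G + 2 * |(discPolar c' χ F G).re| := by
        rw [abs_of_nonneg hG, abs_mul, abs_two]
    _ ≤ discMean c' χ G + 2 * Real.sqrt (discMean c' χ F * discMean c' χ G) := by linarith

/-- **The transfer theorem (asymptotic form):** if under (A) a family of test values `F` has discrete mean
`m·S·𝔓 + o(S·𝔓)` with `m ≥ 0`, and `G` has discrete mean `o(S·𝔓)` (a MEAN-INVISIBLE piece), then `F + G` has
discrete mean `m·S·𝔓 + o(S·𝔓)` — given Prop. 2.2 (i) and Lemma 2.3 (weights `≥ 0`, for Cauchy–Schwarz). The kernel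
form of ls-theory's «TRUE(u + ν-piece) = TRUE(u) + o(main) ⇒ no lever of either sign»: adding an invisible piece
to a design changes neither its main constant nor, therefore, any verdict read from it.
[cite: Zhang2022LandauSiegel, §2 (2.16)–(2.17), Lemma 2.3, §4 Lemma 4.2] -/
theorem mainTerm_add_meanInvisible {m : ℝ} (hm : 0 ≤ m) {S : Scale} (hS : ScaleEventuallyPos S)
    {F G : (D : ℕ) → [NeZero D] → DirichletCharacter ℂ D → Chr D → ℂ → ℂ}
    (hF : ∀ ε : ℝ, 0 < ε → ForAllLarge fun D _ χ => AssumptionA D χ →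
      |discMean c' χ (F D χ) - m * S D χ * frakP D| ≤ ε * S D χ * frakP D)
    (hG : ∀ ε : ℝ, 0 < ε → ForAllLarge fun D _ χ => AssumptionA D χ →
      discMean c' χ (G D χ) ≤ ε * S D χ * frakP D)
    (h22 : Prop22i) (h23 : Lemma23 c') :
    ∀ ε : ℝ, 0 < ε → ForAllLarge fun D _ χ => AssumptionA D χ →
      |discMean c' χ (fun x s => F D χ x s + G D χ x s) - m * S D χ * frakP D| ≤ ε * S D χ * frakP D := by
  intro ε hε
  -- the two small parameters
  set ε₁ : ℝ := ε / 3 with hε₁_def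
  have hε₁ : 0 < ε₁ := by positivity
  have hmε : 0 < m + ε₁ := by positivity
  set η : ℝ := min (ε / 3) (ε ^ 2 / (36 * (m + ε₁))) with hη_def
  have hη : 0 < η := lt_min (by positivity) (by positivity)
  have hη3 : η ≤ ε / 3 := min_le_left _ _
  have hηm : (m + ε₁) * η ≤ ε ^ 2 / 36 := by
    have h1 : η ≤ ε ^ 2 / (36 * (m + ε₁)) := min_le_right _ _
    have h2 : η * (36 * (m + ε₁)) ≤ ε ^ 2 := (le_div_iff₀ (by positivity)).mp h1
    nlinarith
  have h3 : ForAllLarge fun D _ _ => 3 ≤ D := ForAllLarge.of_le 3 fun D _ _ hD _ _ => hD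
  obtain ⟨D₃, hP⟩ := frakP_eventually_pos
  have hP' : ForAllLarge fun D _ _ => 0 < frakP D := ForAllLarge.of_le D₃ fun D _ _ hD _ _ => hP D hD
  refine ((((((hF ε₁ hε₁).and (hG η hη)).and h22).and h23).and h3).and (hS.and hP')).mono ?_
  intro D _ χ _ _ h' hA
  obtain ⟨⟨⟨⟨⟨hF', hG'⟩, h22'⟩, h23'⟩, hD3⟩, hS', hP0⟩ := h'
  have hw := weights_nonneg_of hD3 h23' h22'
  have hX : 0 < S D χ * frakP D := mul_pos (hS' hA) hP0
  have hFm : |discMean c' χ (F D χ) - m * (S D χ * frakP D)| ≤ ε₁ * (S D χ * frakP D) := by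
    simpa only [mul_assoc] using hF' hA
  have hGη : discMean c' χ (G D χ) ≤ η * (S D χ * frakP D) := by
    simpa only [mul_assoc] using hG' hA
  rw [show m * S D χ * frakP D = m * (S D χ * frakP D) by ring,
    show ε * S D χ * frakP D = ε * (S D χ * frakP D) by ring]
  set X : ℝ := S D χ * frakP D with hX_def
  have hF0 := discMean_nonneg hw (F D χ)
  have hG0 := discMean_nonneg hw (G D χ)
  -- size of F and of the geometric mean
  have hFle : discMean c' χ (F D χ) ≤ (m + ε₁) * X := by
    have := (abs_le.mp hFm).2; linarith
  have hprod : discMean c' χ (F D χ) * discMean c' χ (G D χ) ≤ (ε / 6 * X) ^ 2 := by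
    calc discMean c' χ (F D χ) * discMean c' χ (G D χ) ≤ ((m + ε₁) * X) * (η * X) :=
          mul_le_mul hFle hGη hG0 (by positivity)
      _ = ((m + ε₁) * η) * X ^ 2 := by ring
      _ ≤ (ε ^ 2 / 36) * X ^ 2 := mul_le_mul_of_nonneg_right hηm (sq_nonneg X)
      _ = (ε / 6 * X) ^ 2 := by ring
  have hsqrt : Real.sqrt (discMean c' χ (F D χ) * discMean c' χ (G D χ)) ≤ ε / 6 * X := by
    rw [← Real.sqrt_sq (show 0 ≤ ε / 6 * X by positivity)]
    exact Real.sqrt_le_sqrt hprod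
  have halg := abs_discMean_add_sub_le hw (F D χ) (G D χ)
  have htri := abs_sub_le (discMean c' χ (fun x s => F D χ x s + G D χ x s)) (discMean c' χ (F D χ)) (m * X)
  calc |discMean c' χ (fun x s => F D χ x s + G D χ x s) - m * X|
      ≤ (discMean c' χ (G D χ) + 2 * Real.sqrt (discMean c' χ (F D χ) * discMean c' χ (G D χ)))
          + ε₁ * X := htri.trans (add_le_add halg hFm)
    _ ≤ (η * X + 2 * (ε / 6 * X)) + ε / 3 * X := by
        simp only [hε₁_def]; linarith [hGη, hsqrt]
    _ ≤ ε * X := by nlinarith [hη3, hX.le]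

end Transfer

/-! ### Part 8 — PROVED: the class corollary — a νψ overhang added to ANY design is lever-free (given the ruling) -/

section Corollary

variable {c' θ : ℝ} {𝒱 : (ℝ → ℂ) → (ℝ → ℂ) → Prop} {S : Scale}

/-- **No lever of either sign (kernel implication):** given mean-invisibility of the νψ class at scale `S`
(`NuMeanInvisible`, the derivation's claim), a design polynomial family `F` with main constant `m ≥ 0` at scale `S`
keeps the main constant `m` after a νψ overhang `v ∈ 𝒱` of length `θ` is added — so the extended design closes by
positivity iff the original does (neither does, for `m ≥ 0`). [cite: Zhang2022LandauSiegel, §2 (2.16), §4 Lemma 4.2] -/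
theorem mainTerm_add_nuPiece (h : NuMeanInvisible c' θ 𝒱 S) (hS : ScaleEventuallyPos S) {m : ℝ} (hm : 0 ≤ m)
    {F : (D : ℕ) → [NeZero D] → DirichletCharacter ℂ D → Chr D → ℂ → ℂ}
    (hF : ∀ ε : ℝ, 0 < ε → ForAllLarge fun D _ χ => AssumptionA D χ →
      |discMean c' χ (F D χ) - m * S D χ * frakP D| ≤ ε * S D χ * frakP D)
    {v v' : ℝ → ℂ} (hv : 𝒱 v v') (h22 : Prop22i) (h23 : Lemma23 c') :
    ∀ ε : ℝ, 0 < ε → ForAllLarge fun D _ χ => AssumptionA D χ →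
      |discMean c' χ (fun x s => F D χ x s + nuPoly χ x v ⌈bigP D ^ θ⌉₊ s) - m * S D χ * frakP D|
        ≤ ε * S D χ * frakP D :=
  mainTerm_add_meanInvisible hm hS hF (G := fun D _ χ x s => nuPoly χ x v ⌈bigP D ^ θ⌉₊ s)
    (fun ε hε => h.2 v v' hv ε hε) h22 h23

end Corollary

end KnifeEdge

end Literature.NumberTheory.LFunctions.Zhang2022

end
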